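import Summits.KontsevichZagierPeriods.Zeta5Search.LaiSweepShard

/-!
# `κ₃` sweep certificate — shard file 030 of 127 (shards 210–216 of 889)

HONEST FRAMING. Systematic search; no irrationality claim unless certified. This file only checks,
by `decide +kernel`, shards 210–216 of the order-cell sweep of the `κ₃` point `(74, 2180, 444; δ74)`
(engine `LaiSweepEngine`, soundness `LaiSweepJump/Free/Eval/Shard/Kappa3`; a shard is `⟨regime, n,
p, q, p', q', Lo, Up⟩`: `n` cells from `p/q` to `p'/q'` with integer rate sums in `[Lo, Up]`, `K =
128`, `D = 2^40`). It draws NO conclusion: only the capstone `LaiKappa3SweepCert`, which needs all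
127 shard files, does. Kernel cost of this file ≈ 560 cells × 0.3 s.
-/

namespace Summit.KontsevichZagierPeriods.Zeta5Search.Sweep

set_option maxHeartbeats 100000000 in
/-- Shard 210: 80 cells of regime B from `58/397` to `33/224`.
[cite: Lai2024BallRivoal, §4 Lemma 4.3] -/
theorem shard210 :
    Shard.check 128 (2^40)
      ⟨true, 80, 58, 397, 33, 224, 43137757264684, 43737680955378⟩ = true := by
  decide +kernel

set_option maxHeartbeats 100000000 in
/-- Shard 211: 80 cells of regime B from `33/224` to `26/175`.
[cite: Lai2024BallRivoal, §4 Lemma 4.3] -/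
theorem shard211 :
    Shard.check 128 (2^40)
      ⟨true, 80, 33, 224, 26, 175, 43754243865430, 44374393629099⟩ = true := by
  decide +kernel

set_option maxHeartbeats 100000000 in
/-- Shard 212: 80 cells of regime B from `26/175` to `34/227`.
[cite: Lai2024BallRivoal, §4 Lemma 4.3] -/
theorem shard212 :
    Shard.check 128 (2^40)
      ⟨true, 80, 26, 175, 34, 227, 41793808296118, 42396379995857⟩ = true := by
  decide +kernel

set_option maxHeartbeats 100000000 in
/-- Shard 213: 80 cells of regime B from `34/227` to `29/192`.
[cite: Lai2024BallRivoal, §4 Lemma 4.3] -/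
theorem shard213 :
    Shard.check 128 (2^40)
      ⟨true, 80, 34, 227, 29, 192, 43420535300435, 44061491187536⟩ = true := by
  decide +kernel

set_option maxHeartbeats 100000000 in
/-- Shard 214: 80 cells of regime B from `29/192` to `39/256`.
[cite: Lai2024BallRivoal, §4 Lemma 4.3] -/
theorem shard214 :
    Shard.check 128 (2^40)
      ⟨true, 80, 29, 192, 39, 256, 44321176069519, 44986073673017⟩ = true := by
  decide +kernel

set_option maxHeartbeats 100000000 in
/-- Shard 215: 80 cells of regime B from `39/256` to `39/254`.
[cite: Lai2024BallRivoal, §4 Lemma 4.3] -/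
theorem shard215 :
    Shard.check 128 (2^40)
      ⟨true, 80, 39, 256, 39, 254, 40567450867185, 41186207736352⟩ = true := by
  decide +kernel

set_option maxHeartbeats 100000000 in
/-- Shard 216: 80 cells of regime B from `39/254` to `59/381`.
[cite: Lai2024BallRivoal, §4 Lemma 4.3] -/
theorem shard216 :
    Shard.check 128 (2^40)
      ⟨true, 80, 39, 254, 59, 381, 43945866978301, 44638893936398⟩ = true := by
  decide +kernel

/-- The checked shards of this file, in order. [folklore] -/
def shards030 : List (CheckedShard 128 (2^40)) :=
  [⟨_, shard210⟩, ⟨_, shard211⟩, ⟨_, shard212⟩, ⟨_, shard213⟩, ⟨_, shard214⟩,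
    ⟨_, shard215⟩, ⟨_, shard216⟩]

end Summit.KontsevichZagierPeriods.Zeta5Search.Sweep
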